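import Summits.Ventures.PercRepro.Night2CoverBasesFat

/-!
# PercRepro — covering bases through two hyperplanes: inclusion–exclusion (night-2, gen 21)

Two rank-`≤ q` sets `H₀, H₁ ⊇ K` of `G` exclude the `ρ`-subsets of `S ∖ K` inside either trace, and the two excluded
families meet in the `ρ`-subsets of the common trace `(S ∖ K) ∩ H₀ ∩ H₁`:

* `powersetCard_inter_eq`: `powersetCard ρ A ∩ powersetCard ρ B = powersetCard ρ (A ∩ B)`;
* **`card_coverBases_le_of_two_subset_rank`**:
  `#coverBases(S) + C(|S′ ∩ H₀|, ρ) + C(|S′ ∩ H₁|, ρ) ≤ C(|S′|, ρ) + C(|S′ ∩ H₀ ∩ H₁|, ρ)` (`S′ = S ∖ K`);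
* `card_inter_inter_le`: `|S′ ∩ H₀ ∩ H₁| ≤ |S′| − |S′ ∖ H₀| − |S′ ∖ H₁| + |(G ∖ H₀) ∩ (G ∖ H₁)|` — the common trace is
  small when the two missed sets overlap little (for two DISTINCT hyperplanes of `M|G` the missed sets are not nested).
The cell use (`(3, 1)` at `|G| = 17`, `(3, 0)` at `|G| = 13` modulo `cl B₁ = cl B₀`; proofs/NIGHT-2-g21.md §4‴) is left to the
successor: the count function is the minimum over `|S′ ∖ H₀|, |S′ ∖ H₁| ≤ 2` of the inclusion–exclusion value.
-/

namespace PercRepro.Shadow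

open Finset PerFlat ThmH

variable {α : Type*} [DecidableEq α] {M : Matroid α} [M.Finite]

/-- `powersetCard ρ A ∩ powersetCard ρ B = powersetCard ρ (A ∩ B)`. -/
theorem powersetCard_inter_eq (ρ : ℕ) (A B : Finset α) :
    A.powersetCard ρ ∩ B.powersetCard ρ = (A ∩ B).powersetCard ρ := by
  ext T
  simp only [Finset.mem_inter, Finset.mem_powersetCard, Finset.subset_inter_iff]
  constructor
  · rintro ⟨⟨hA, hc⟩, ⟨hB, -⟩⟩
    exact ⟨⟨hA, hB⟩, hc⟩
  · rintro ⟨⟨hA, hB⟩, hc⟩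
    exact ⟨⟨hA, hc⟩, ⟨hB, hc⟩⟩

open scoped Classical in
/-- **Inclusion–exclusion over two rank-`≤ q` sets through the coloops**: no covering basis lies inside `H₀` or
inside `H₁`. -/
theorem card_coverBases_le_of_two_subset_rank {q ρ : ℕ} {G : Finset α} (hk : kColoops M G + ρ = q + 1)
    {H₀ H₁ : Finset α} (hK₀ : coloops M G ⊆ H₀) (hH₀ : M.eRk (H₀ : Set α) ≤ (q : ℕ∞))
    (hK₁ : coloops M G ⊆ H₁) (hH₁ : M.eRk (H₁ : Set α) ≤ (q : ℕ∞)) (S : Finset α) :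
    (coverBases M G S ρ).card + ((S \ coloops M G) ∩ H₀).card.choose ρ +
        ((S \ coloops M G) ∩ H₁).card.choose ρ ≤
      (S \ coloops M G).card.choose ρ + ((S \ coloops M G) ∩ H₀ ∩ H₁).card.choose ρ := by
  set S' := S \ coloops M G with hS'
  set P₀ := (S' ∩ H₀).powersetCard ρ with hP₀
  set P₁ := (S' ∩ H₁).powersetCard ρ with hP₁
  -- no covering basis inside a rank-`≤ q` trace
  have hnot : ∀ {H : Finset α}, coloops M G ⊆ H → M.eRk (H : Set α) ≤ (q : ℕ∞) →
      ∀ T ∈ coverBases M G S ρ, T ∉ (S' ∩ H).powersetCard ρ := by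
    intro H hKH hH T hT hTH
    unfold coverBases at hT
    rw [Finset.mem_filter] at hT
    obtain ⟨hTp, hind⟩ := hT
    rw [Finset.mem_powersetCard] at hTp hTH
    have hTK : Disjoint (coloops M G) T := by
      rw [Finset.disjoint_left]
      intro x hx hxT
      exact (Finset.mem_sdiff.1 (hTp.1 hxT)).2 hx
    have hcard : (coloops M G ∪ T).card = q + 1 := by
      rw [Finset.card_union_of_disjoint hTK, ← kColoops_eq_card_coloops, hTp.2, hk]
    have hKT : ((coloops M G ∪ T : Finset α) : Set α) ⊆ (H : Set α) := by
      rw [Finset.coe_subset]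
      exact Finset.union_subset hKH (hTH.1.trans Finset.inter_subset_right)
    have h1 := hind.encard_le_eRk_of_subset hKT
    rw [Set.encard_coe_eq_coe_finsetCard, hcard] at h1
    have h2 : ((q + 1 : ℕ) : ℕ∞) ≤ (q : ℕ∞) := h1.trans hH
    have h3 : q + 1 ≤ q := by exact_mod_cast h2
    omega
  have hsub : coverBases M G S ρ ⊆ S'.powersetCard ρ \ (P₀ ∪ P₁) := by
    intro T hT
    rw [Finset.mem_sdiff, Finset.mem_union]
    refine ⟨?_, ?_⟩
    · unfold coverBases at hT
      exact (Finset.mem_filter.1 hT).1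
    · rintro (h | h)
      · exact hnot hK₀ hH₀ T hT h
      · exact hnot hK₁ hH₁ T hT h
  have hUsub : P₀ ∪ P₁ ⊆ S'.powersetCard ρ := by
    apply Finset.union_subset
    · exact Finset.powersetCard_mono Finset.inter_subset_left
    · exact Finset.powersetCard_mono Finset.inter_subset_left
  have h1 := Finset.card_le_card hsub
  rw [Finset.card_sdiff_of_subset hUsub] at h1
  have h2 := Finset.card_union_add_card_inter P₀ P₁
  have hPP : P₀ ∩ P₁ = (S' ∩ H₀ ∩ H₁).powersetCard ρ := by
    rw [hP₀, hP₁, powersetCard_inter_eq]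
    congr 1
    ext x
    simp only [Finset.mem_inter]
    tauto
  rw [hPP, Finset.card_powersetCard, Finset.card_powersetCard, Finset.card_powersetCard] at h2
  rw [Finset.card_powersetCard] at h1
  have hUle := Finset.card_le_card hUsub
  rw [Finset.card_powersetCard] at hUle
  omega

/-- The common trace is small when the missed sets overlap little:
`|S′ ∩ H₀ ∩ H₁| + |S′ ∖ H₀| + |S′ ∖ H₁| ≤ |S′| + |(G ∖ H₀) ∩ (G ∖ H₁)|` for `S′ ⊆ G`. -/
theorem card_inter_inter_le {G H₀ H₁ S' : Finset α} (hS : S' ⊆ G) :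
    (S' ∩ H₀ ∩ H₁).card + (S' \ H₀).card + (S' \ H₁).card ≤ S'.card + ((G \ H₀) ∩ (G \ H₁)).card := by
  have e1 : S' = (S' ∩ H₀ ∩ H₁) ∪ ((S' \ H₀) ∪ (S' \ H₁)) := by
    ext x
    simp only [Finset.mem_union, Finset.mem_inter, Finset.mem_sdiff]
    tauto
  have hdisj : Disjoint (S' ∩ H₀ ∩ H₁) ((S' \ H₀) ∪ (S' \ H₁)) := by
    rw [Finset.disjoint_left]
    intro x hx hx'
    simp only [Finset.mem_inter] at hx
    simp only [Finset.mem_union, Finset.mem_sdiff] at hx'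
    tauto
  have h1 : S'.card = (S' ∩ H₀ ∩ H₁).card + ((S' \ H₀) ∪ (S' \ H₁)).card := by
    conv_lhs => rw [e1]
    exact Finset.card_union_of_disjoint hdisj
  have h2 := Finset.card_union_add_card_inter (S' \ H₀) (S' \ H₁)
  have h3 : (S' \ H₀) ∩ (S' \ H₁) ⊆ (G \ H₀) ∩ (G \ H₁) := by
    intro x hx
    simp only [Finset.mem_inter, Finset.mem_sdiff] at hx ⊢
    exact ⟨⟨hS hx.1.1, hx.1.2⟩, ⟨hS hx.2.1, hx.2.2⟩⟩
  have h4 := Finset.card_le_card h3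
  omega

end PercRepro.Shadow
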